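import Mathlib.RingTheory.AlgebraicIndependent.TranscendenceBasis
import Mathlib.RingTheory.MvPolynomial.IrreducibleQuadratic
import Mathlib.FieldTheory.IntermediateField.Adjoin.Basic
import Mathlib.FieldTheory.IsAlgClosed.Basic
import Mathlib.SetTheory.Cardinal.Continuum
import Literature.ModelTheory.ExponentialFields.ExponentialField
import Literature.NumberTheory.Transcendental.ZilberField
import Literature.NumberTheory.Transcendental.SchanuelEclEmptyProofs
import HarnessLib

/-!
# Barrier (Schanuel): Zilber's other axioms, categoricity and quasiminimality do not force the Schanuel property (Bays–Kirby 2018, §9.2)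

`Literature/Barriers/Schanuel/AxiomsDoNotForceSchanuel.lean` — barrier catalogue entry (D-0021)
for the summit `Schanuel` (`Summits/Schanuel/Schanuel/Statement.lean`; the summit is
`Literature.SchanuelProperty ℂ` by `Iff.rfl`, see route `Summits/Schanuel/Schanuel/Theses/Zilber.lean`).
A model-theoretic no-go, distinct from the functional (Ax–Schanuel) barrier: Bays and Kirby
construct, for every irreducible `P ∈ ℤ[x, y]`, a quasiminimal exponential field `𝔹_P` of
cardinality continuum satisfying Zilber's axioms ELA + standard kernel + strong
exponential-algebraic closedness + countable closure, categorical in its own axiomatisation, in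
which the analogues `ε = exp 1` and `τ` (`ker exp = τℤ`) of `e` and `2πi` satisfy `P(ε, τ) = 0` —
so the Schanuel property FAILS (`not_schanuelProperty_of_kernel_relation`, PROVED) — and conclude:
"soft methods which ignore transcendental number theory and analytic considerations cannot hope
to work".

## What the source prints (verified on the page: arXiv:1512.04262 = Algebra & Number Theory 12 (2018) 493–549)

* §1.1 (arXiv p. 3): the axioms `ECF_{SK,CCP}`: "two algebraic axioms which are obviously true in
  `ℂ_exp` and then three more axioms: Schanuel's conjecture, strong exponential-algebraic
  closedness, and the countable closure property"; Theorem 1.2: "Up to isomorphism there is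
  exactly one model of the axioms `ECF_{SK,CCP}` of each uncountable cardinality, and it is
  quasiminimal"; Theorem 1.4: "Conjecture 1.3 [`ℂ_exp ≅ 𝔹`] is true if and only if Schanuel's
  conjecture is true and `ℂ_exp` is strongly exponentially-algebraically closed"; "Schanuel's
  conjecture is considered out of reach, since even the very simple consequence that the numbers
  `e` and `π` are algebraically independent is unknown"; Theorem 1.5: "If `ℂ_exp` is
  exponentially-algebraically closed then it is quasiminimal" and (abstract) "Schanuel's
  conjecture is not required as a condition for quasiminimality."
* §9.1, Theorem 9.1 (arXiv p. 28): the axioms 1. ELA-field (algebraically closed, characteristic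
  zero, `exp` a surjective homomorphism `𝔾_a(F) → 𝔾_m(F)`); 2. Standard kernel ("the kernel of
  `exp` is an infinite cyclic group generated by a transcendental element `τ`"); 3. Schanuel
  Property (`δ(x̄) = td(x̄, exp x̄) − ldim_ℚ(x̄) ≥ 0`); 4. Strong exponential-algebraic closedness
  ("If `V` is a rotund, additively and multiplicatively free subvariety of `𝔾_aⁿ × 𝔾_mⁿ` defined
  over `F` and of dimension `n`, and `ā` is a finite tuple from `F`, then there is `x̄` in `F`
  such that `(x̄, e^x̄) ∈ V` and `x̄` is `ℚ`-linearly independent over `ā`"); 5. Countable Closure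
  Property; "The predimension inequality is precisely Schanuel's conjecture"; `𝔹` := the model
  of cardinality continuum.
* §9.2 "Incorporating a counterexample to Schanuel's conjecture" (arXiv p. 28): "we choose an
  irreducible polynomial `P(x, y) ∈ ℤ[x, y]` and take `(ε, τ)` to be a generic zero of the
  polynomial `P(x, y)`. (We assume that `P` is such that neither `ε` nor `τ` is zero.) … define
  `Γ(K)` to be the graph of a homomorphism from the `ℚ`-linear span of `τ` and `1`, with
  `τ/m ↦ ω_m` as above and `1/m ↦ ε_m`. Now the construction gives us a canonical model `𝔹_P`,
  the unique model of cardinality continuum of almost the same list of axioms as those for `𝔹`,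
  except that Schanuel's conjecture has this exception with the formal analogues `ε` and `τ` of
  `e` and `2πi` being algebraically dependent via the polynomial `P`. More precisely, the
  predimension axiom is replaced by an axiom scheme stating that `exp(1)` and `τ` are
  transcendental, that `P(exp(1), τ) = 0`, and the condition that for all tuples `ā`,
  `td(ā, exp(ā)/τ, exp(1)) − ldim_ℚ(ā/τ, 1) ≥ 0`. More generally, we can take any finitely
  generated partial exponential field with standard kernel … as `F_base` and do the same
  construction to build a quasiminimal exponential field `𝕄(F_base)` of size continuum with
  counterexamples to the Schanuel property within a finite-dimensional `ℚ`-vector space, but with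
  the Schanuel property holding over that vector space. Each `𝕄(F_base)` is unique up to
  isomorphism as a model of appropriate axioms, just as `𝔹` is. One could conjecture that `ℂ_exp`
  is isomorphic to one of these. Several people have asked us if it might be possible to prove
  Schanuel's conjecture easily by some method showing that `ℂ_exp` must be isomorphic to `𝔹`,
  just because `𝔹` is categorical. Examples such as these show that soft methods which ignore
  transcendental number theory and analytic considerations cannot hope to work."

## Lean rendering

* All exponential-field vocabulary is the tree's (`Literature/NumberTheory/Transcendental/
  ZilberField.lean`, `Literature/ModelTheory/ExponentialFields/ExponentialField.lean`):
  `Literature.ModelTheory.ExponentialFields.ExponentialRing`, `Literature.ModelTheory.ExponentialFields.ExponentialRing.expKernel`, `IsSurjectiveOntoUnits`,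
  `Literature.ModelTheory.ExponentialFields.SchanuelProperty`, `Literature.NumberTheory.Transcendental.HasCountableClosureProperty`, `Language.expRing.IsQuasiminimal`, and
  Bays–Kirby's axiom 4 in its printed "`ℚ`-linearly independent over `ā`" form
  `Literature.NumberTheory.Transcendental.IsLinIndepExpAlgClosed` (Kirby's scheme; the tree's genericity form
  `Literature.NumberTheory.Transcendental.IsStronglyExpAlgClosed` implies it, `IsStronglyExpAlgClosed.isLinIndepExpAlgClosed`).
* "`P` irreducible with a generic zero `(ε, τ)`, `ε, τ ≠ 0`" (and, as the replaced axiom scheme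
  demands, `exp 1`, `τ` transcendental) is rendered by `IsAdmissibleRelation P`: `P` irreducible
  in `ℤ[x, y]` of positive degree in each variable.
* `baysKirby2018_modelsWithoutSchanuel` is the named fact (existence, for each admissible `P`, of
  the exponential field `𝔹_P` with the printed properties; uniqueness/categoricity of `𝔹_P` is
  recorded in prose only) — the ONLY named fact of this barrier file (D-0026); it is not
  discharged here: the sibling proof file `AxiomsDoNotForceSchanuelProofs.lean` constructs the
  §9.2 base inside `ℂ` (a finitely generated partial exponential field with standard kernel,
  `Literature.NumberTheory.Transcendental.IsStdKernelPartialExpField`) and reduces it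
  (`baysKirby2018_modelsWithoutSchanuel_of_softModels`, PROVED) to Bays–Kirby's construction of
  the model `𝕄(F_base)` over such a base (Thm 1.7 + Thm 8.2, the body of the paper — carried
  there as an explicit hypothesis, not vendored as a further named fact, D-0026). PROVED here: any exponential field in
  which `exp τ = 1`, `τ` transcendental and `P(exp 1, τ) = 0` for some `P ≠ 0` violates the
  Schanuel property (`not_schanuelProperty_of_kernel_relation`, witness tuple `(1, τ)`); hence,
  from the named fact, the explicit technique class `SoftDerivationOfSchanuel` (": every
  exponential field of cardinality `𝔠` with axioms 1, 2, 4, 5 and quasiminimality has the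
  Schanuel property") is REFUTED (`not_softDerivationOfSchanuel`), using the admissible `P = x − y`.
* The catalogue declaration `AxiomsDoNotForceSchanuel` (named after the file) is the conjunction
  of these two PROVED statements — the mechanism, and the refutation of the technique class from
  the named fact — and is DISCHARGED (`axiomsDoNotForceSchanuel_holds`), as in the sibling entries
  `AxSchanuelFunctionalNotNumerical` / `AlgebraicIndependenceOfLogarithms`. (Until 2026-08-15 it
  was the alias `:= baysKirby2018_modelsWithoutSchanuel`, which counted the one existence
  statement twice as an unproved fact; restated under the D-0026 split review, the named fact
  itself being unchanged.)
* `SoftDerivationOfSchanuel` is thus the statement the barrier REFUTES — a closed technique-class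
  proposition, not a claim of the source, never to be discharged (`SoftDerivationOfSchanuel_holds`
  together with the named fact would prove `False`). The class of OBJECTS it quantifies over is
  the parametrised predicate `IsSoftZilberField` (D-0021 "technique class as an explicit
  definition"; a predicate, not a named fact): `softDerivationOfSchanuel_iff`,
  `exists_isSoftZilberField_not_schanuelProperty`, `not_forall_isSoftZilberField_schanuelProperty`.

## References

* [BaysKirby2018ANT] M. Bays, J. Kirby, *Pseudo-exponential maps, variants, and quasiminimality*,
  Algebra & Number Theory 12 (2018) 493–549 (arXiv:1512.04262v4): §1.1 Thms 1.2, 1.4, 1.5;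
  §9.1 Thm 9.1; §9.2.
* [Zilber2005PseudoExp] B. Zilber, *Pseudo-exponentiation on algebraically closed fields of characteristic
  zero*, Ann. Pure Appl. Logic 132 (2005) 67–95 (the axioms; tree file `ZilberField.lean`).
* [Kirby2013Axioms] J. Kirby, *A note on the axioms for Zilber's pseudo-exponential fields*, NDJFL 54
  (2013), §2.3 (axiom 4 in linear-independence form; tree `Literature.NumberTheory.Transcendental.IsLinIndepExpAlgClosed`).
-/

noncomputable section

open Cardinal IntermediateField
open FirstOrder

namespace Literature.Barriers.Schanuel

/-! ### Admissible relations `P(ε, τ) = 0` -/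

/-- The polynomials `P ∈ ℤ[x, y]` of Bays–Kirby §9.2: "an irreducible polynomial
`P(x, y) ∈ ℤ[x, y]` … (We assume that `P` is such that neither `ε` nor `τ` is zero)" for a generic
zero `(ε, τ)`, the replaced axiom scheme stating moreover that `exp(1)` and `τ` are transcendental —
i.e. `P` irreducible of positive degree in each of the two variables (variable `0` = `x` ↔ `ε`,
variable `1` = `y` ↔ `τ`). [cite: BaysKirby2018ANT, §9.2] -/
def IsAdmissibleRelation (P : MvPolynomial (Fin 2) ℤ) : Prop :=
  Irreducible P ∧ 0 < P.degreeOf 0 ∧ 0 < P.degreeOf 1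

/-- **Bays–Kirby 2018, §9.2 (with Thm 1.7/9.1): pseudo-exponential fields incorporating a
counterexample to Schanuel's conjecture.** For every admissible `P ∈ ℤ[x, y]` there is an
exponential field `F = 𝔹_P` of cardinality continuum which is an ELA-field (algebraically closed of
characteristic zero, `exp` surjective onto `Fˣ`) with standard kernel `ker exp = τℤ`, `τ`
transcendental, satisfying strong exponential-algebraic closedness (axiom 4, in its printed
"`ℚ`-linearly independent over `ā`" form) and the countable closure property, quasiminimal, and in
which `exp 1` is transcendental and `P(exp 1, τ) = 0`. (Printed: "the unique model of cardinality
continuum of almost the same list of axioms as those for `𝔹`, except that Schanuel's conjecture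
has this exception"; "a quasiminimal exponential field … of size continuum with counterexamples to
the Schanuel property".) Named fact; users take `(h : baysKirby2018_modelsWithoutSchanuel)`.
[cite: BaysKirby2018ANT, §9.2 and Theorem 9.1] -/
def baysKirby2018_modelsWithoutSchanuel : Prop :=
  ∀ P : MvPolynomial (Fin 2) ℤ, IsAdmissibleRelation P →
    ∃ (F : Type) (_ : Field F) (_ : CharZero F) (_ : Literature.ModelTheory.ExponentialFields.ExponentialRing F),
      #F = 𝔠 ∧ IsAlgClosed F ∧ Literature.ModelTheory.ExponentialFields.ExponentialRing.IsSurjectiveOntoUnits F ∧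
      (∃ τ : F, Transcendental ℚ τ ∧
        Literature.ModelTheory.ExponentialFields.ExponentialRing.expKernel F = AddSubgroup.zmultiples τ ∧
        Transcendental ℚ (Literature.ModelTheory.ExponentialFields.ExponentialRing.exp (1 : F)) ∧
        MvPolynomial.aeval ![Literature.ModelTheory.ExponentialFields.ExponentialRing.exp (1 : F), τ] P = 0) ∧
      Literature.NumberTheory.Transcendental.IsLinIndepExpAlgClosed F ∧ Literature.NumberTheory.Transcendental.HasCountableClosureProperty F ∧
      Literature.ModelTheory.ExponentialFields.Language.expRing.IsQuasiminimal F

/-! ### A kernel relation kills the Schanuel property (proved) -/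

variable {F : Type*} [Field F] [CharZero F] [Literature.ModelTheory.ExponentialFields.ExponentialRing F]

omit [Literature.ModelTheory.ExponentialFields.ExponentialRing F] in
/-- `1, τ` are `ℚ`-linearly independent when `τ` is transcendental over `ℚ`. [folklore] -/
theorem linearIndependent_one_tau {τ : F} (hτ : Transcendental ℚ τ) :
    LinearIndependent ℚ ![(1 : F), τ] := by
  rw [LinearIndependent.pair_iff]
  intro s t hst
  by_cases ht : t = 0
  · subst ht
    simp only [zero_smul, add_zero] at hst
    rw [Rat.smul_def, mul_one] at hst
    exact ⟨by exact_mod_cast hst, rfl⟩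
  · exfalso
    apply hτ
    -- `τ = -s/t` is rational, hence algebraic
    rw [Rat.smul_def, Rat.smul_def, mul_one] at hst
    have ht' : (t : F) ≠ 0 := by exact_mod_cast ht
    have hτeq : τ = ((-s / t : ℚ) : F) := by
      push_cast
      field_simp
      linear_combination hst
    rw [hτeq]
    simpa using isAlgebraic_algebraMap (R := ℚ) (A := F) (-s / t)

/-- **A relation `P(exp 1, τ) = 0` with `exp τ = 1`, `τ` transcendental, `P ≠ 0`, violates the
Schanuel property** (PROVED): the tuple `(1, τ)` is `ℚ`-linearly independent while
`ℚ(1, τ, exp 1, exp τ) = ℚ(exp 1, τ)` has transcendence degree `≤ 1 < 2`, since `exp 1, τ` are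
algebraically dependent. This is why each `𝔹_P` is a counterexample to the Schanuel property
("Schanuel's conjecture has this exception with the formal analogues `ε` and `τ` of `e` and `2πi`
being algebraically dependent via the polynomial `P`"). [cite: BaysKirby2018ANT, §9.2] -/
theorem not_schanuelProperty_of_kernel_relation {τ : F} (hτ : Transcendental ℚ τ)
    (hker : Literature.ModelTheory.ExponentialFields.ExponentialRing.exp τ = 1) {P : MvPolynomial (Fin 2) ℤ} (hP : P ≠ 0)
    (hrel : MvPolynomial.aeval ![Literature.ModelTheory.ExponentialFields.ExponentialRing.exp (1 : F), τ] P = 0) :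
    ¬ Literature.ModelTheory.ExponentialFields.SchanuelProperty F := by
  intro hSP
  have h2 := hSP 2 ![(1 : F), τ] (linearIndependent_one_tau hτ)
  set l : Fin 2 → F := ![Literature.ModelTheory.ExponentialFields.ExponentialRing.exp (1 : F), τ] with hl
  -- the generated field sits inside `ℚ(exp 1, τ)`
  have hle : adjoin ℚ (Set.range ![(1 : F), τ] ∪ Set.range (Literature.ModelTheory.ExponentialFields.ExponentialRing.exp ∘ ![(1 : F), τ]))
      ≤ adjoin ℚ (Set.range l) := by
    rw [adjoin_le_iff]
    rintro w (⟨i, rfl⟩ | ⟨i, rfl⟩) <;> fin_cases i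
    · simp
    · simpa using subset_adjoin ℚ (Set.range l) ⟨1, by simp [hl]⟩
    · simp only [Fin.zero_eta, Fin.isValue, Function.comp_apply, Matrix.cons_val_zero,
        SetLike.mem_coe]
      exact subset_adjoin ℚ (Set.range l) ⟨0, by simp [hl]⟩
    · simp [hker]
  have h2' : ((2 : ℕ) : Cardinal) ≤ Algebra.trdeg ℚ (adjoin ℚ (Set.range l)) :=
    h2.trans (trdeg_le_of_injective (IntermediateField.inclusion hle)
      (IntermediateField.inclusion_injective hle))
  -- `l = (exp 1, τ)` generates a field of transcendence degree `≥ 2`, hence is algebraically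
  -- independent (it is then a transcendence basis of `ℚ(l)`, which is algebraic over `ℚ[l]`)
  have hind : AlgebraicIndependent ℚ l := by
    let A : IntermediateField ℚ F := adjoin ℚ (Set.range l)
    let x : Fin 2 → A := fun i => ⟨l i, subset_adjoin ℚ _ ⟨i, rfl⟩⟩
    haveI : Algebra.IsAlgebraic (Algebra.adjoin ℚ (Set.range x)) A := by
      have hx : Set.range x = ((↑) : A → F) ⁻¹' Set.range l := by
        ext a
        constructor
        · rintro ⟨i, rfl⟩; exact ⟨i, rfl⟩
        · rintro ⟨i, hi⟩; exact ⟨i, Subtype.ext hi⟩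
      rw [hx]
      exact Literature.NumberTheory.Transcendental.isAlgebraic_adjoin_over_algebraAdjoin _
    have hB := Algebra.IsAlgebraic.isTranscendenceBasis_of_lift_le_trdeg_of_finite ℚ x
      (by simpa using h2')
    exact hB.1.map' (f := A.val) (fun a b hab => Subtype.ext hab)
  -- but `P ≠ 0` (mapped to `ℚ`-coefficients) is a relation
  have hPQ : MvPolynomial.map (Int.castRingHom ℚ) P ≠ 0 := by
    intro h0
    apply hP
    exact MvPolynomial.map_injective (Int.castRingHom ℚ) Int.cast_injective (by simpa using h0)
  apply hPQ
  apply hind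
  rw [map_zero]
  have : MvPolynomial.aeval l (MvPolynomial.map (Int.castRingHom ℚ) P) = MvPolynomial.aeval l P := by
    rw [show Int.castRingHom ℚ = algebraMap ℤ ℚ from rfl, MvPolynomial.aeval_map_algebraMap]
  rw [this]
  exact hrel

/-! ### The technique class, explicit, and its refutation from the named fact -/

/-- **"Soft" derivations of the Schanuel property** — the technique class of Bays–Kirby's remark
made explicit as one proposition: every exponential field of cardinality continuum which is an
ELA-field with standard kernel, satisfies axiom 4 (strong exponential-algebraic closedness in the
linear-independence form) and the countable closure property, and is quasiminimal, has the Schanuel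
property. Any argument deriving `SchanuelProperty ℂ` from these properties of `ℂ_exp` alone ("just
because `𝔹` is categorical") would prove this proposition. This is the TECHNIQUE CLASS the
barrier REFUTES (`not_softDerivationOfSchanuel`, from the named fact; the source prints the
counter-models `𝔹_P`, §9.2), not a claim of the source: it is never to be discharged. As a class of
objects: `IsSoftZilberField`, `softDerivationOfSchanuel_iff`. [cite: BaysKirby2018ANT, §9.2] -/
def SoftDerivationOfSchanuel : Prop :=
  ∀ (F : Type) [Field F] [CharZero F] [Literature.ModelTheory.ExponentialFields.ExponentialRing F],
    #F = 𝔠 → IsAlgClosed F → Literature.ModelTheory.ExponentialFields.ExponentialRing.IsSurjectiveOntoUnits F → Literature.NumberTheory.Transcendental.HasStandardKernel F →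
    Literature.NumberTheory.Transcendental.IsLinIndepExpAlgClosed F → Literature.NumberTheory.Transcendental.HasCountableClosureProperty F →
    Literature.ModelTheory.ExponentialFields.Language.expRing.IsQuasiminimal F → Literature.ModelTheory.ExponentialFields.SchanuelProperty F

/-- `x − y` (variables `0`, `1`) is an admissible relation: irreducible in `ℤ[x, y]` (total degree
`1`, a coefficient equal to `1`) and of degree `1` in each variable. [folklore] -/
theorem isAdmissibleRelation_X_sub_X :
    IsAdmissibleRelation (MvPolynomial.X 0 - MvPolynomial.X 1 : MvPolynomial (Fin 2) ℤ) := by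
  classical
  have hc0 : (MvPolynomial.X 0 - MvPolynomial.X 1 : MvPolynomial (Fin 2) ℤ).coeff
      (Finsupp.single 0 1) = 1 := by
    simp [MvPolynomial.coeff_X, Finsupp.single_eq_single_iff]
  have hc1 : (MvPolynomial.X 0 - MvPolynomial.X 1 : MvPolynomial (Fin 2) ℤ).coeff
      (Finsupp.single 1 1) = -1 := by
    simp [MvPolynomial.coeff_X, Finsupp.single_eq_single_iff]
  have hs0 : Finsupp.single (0 : Fin 2) 1 ∈
      (MvPolynomial.X 0 - MvPolynomial.X 1 : MvPolynomial (Fin 2) ℤ).support := by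
    rw [MvPolynomial.mem_support_iff, hc0]; exact one_ne_zero
  have hs1 : Finsupp.single (1 : Fin 2) 1 ∈
      (MvPolynomial.X 0 - MvPolynomial.X 1 : MvPolynomial (Fin 2) ℤ).support := by
    rw [MvPolynomial.mem_support_iff, hc1]; norm_num
  have htd : (MvPolynomial.X 0 - MvPolynomial.X 1 : MvPolynomial (Fin 2) ℤ).totalDegree = 1 := by
    apply le_antisymm
    · refine (MvPolynomial.totalDegree_sub _ _).trans ?_
      simp [MvPolynomial.totalDegree_X]
    · simpa using MvPolynomial.le_totalDegree hs0
  refine ⟨?_, ?_, ?_⟩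
  · refine MvPolynomial.irreducible_of_totalDegree_eq_one htd ?_
    intro x hx
    have h1 := hx (Finsupp.single 0 1)
    rw [hc0] at h1
    exact isUnit_of_dvd_one h1
  · exact lt_of_lt_of_le zero_lt_one (by simpa using MvPolynomial.monomial_le_degreeOf 0 hs0)
  · exact lt_of_lt_of_le zero_lt_one (by simpa using MvPolynomial.monomial_le_degreeOf 1 hs1)

/-- **The barrier as a refutation** (PROVED from the named fact): Bays–Kirby's models show that
`SoftDerivationOfSchanuel` is false — `𝔹_{x−y}` has cardinality `𝔠`, axioms 1, 2, 4, 5 and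
quasiminimality, and `exp 1 = τ ∈ ker exp` with `τ` transcendental, so it has not the Schanuel
property (`not_schanuelProperty_of_kernel_relation`). "Examples such as these show that soft
methods which ignore transcendental number theory and analytic considerations cannot hope to
work." [cite: BaysKirby2018ANT, §9.2] -/
theorem not_softDerivationOfSchanuel (h : baysKirby2018_modelsWithoutSchanuel) :
    ¬ SoftDerivationOfSchanuel := by
  intro hsoft
  obtain ⟨F, _, _, _, hcard, hac, hsurj, ⟨τ, hτ, hker, -, hrel⟩, hlin, hccp, hqm⟩ :=
    h _ isAdmissibleRelation_X_sub_X
  have hSK : Literature.NumberTheory.Transcendental.HasStandardKernel F := ⟨τ, hτ, hker⟩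
  have hSP : Literature.ModelTheory.ExponentialFields.SchanuelProperty F := hsoft F hcard hac hsurj hSK hlin hccp hqm
  have hτker : Literature.ModelTheory.ExponentialFields.ExponentialRing.exp τ = 1 := by
    rw [← Literature.ModelTheory.ExponentialFields.ExponentialRing.mem_expKernel_iff, hker]
    exact AddSubgroup.mem_zmultiples τ
  have hP : (MvPolynomial.X 0 - MvPolynomial.X 1 : MvPolynomial (Fin 2) ℤ) ≠ 0 :=
    isAdmissibleRelation_X_sub_X.1.ne_zero
  exact not_schanuelProperty_of_kernel_relation hτ hτker hP hrel hSP

/-- **Barrier (catalogue declaration): Zilber's other axioms, categoricity and quasiminimality do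
not force the Schanuel property.** Named after the file (the gate indexes barriers by the
declaration carrying the block); it is the conjunction of the two PROVED no-go statements of this
file, DISCHARGED by `axiomsDoNotForceSchanuel_holds`: (i) the mechanism — in every exponential
field of characteristic zero, a kernel element `τ` (`exp τ = 1`) which is transcendental and
algebraically dependent with `exp 1` via some `P ≠ 0` (the replaced axiom scheme of §9.2:
"`exp(1)` and `τ` are transcendental, `P(exp(1), τ) = 0`") makes the Schanuel property fail
(`not_schanuelProperty_of_kernel_relation`); (ii) the refutation — Bays–Kirby's existence
statement `baysKirby2018_modelsWithoutSchanuel` (the barrier's single NAMED FACT: for every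
admissible `P`, a quasiminimal exponential field `𝔹_P` of cardinality `𝔠` with axioms 1, 2, 4, 5
and `P(exp 1, τ) = 0`; reduced in `AxiomsDoNotForceSchanuelProofs.lean`, over the §9.2 base built
inside `ℂ`, to Bays–Kirby's construction of `𝕄(F_base)`, Thm 1.7 + Thm 8.2, an explicit
hypothesis there) refutes the explicit
technique class `SoftDerivationOfSchanuel` (`not_softDerivationOfSchanuel`,
`AxiomsDoNotForceSchanuel.not_soft`; through the class of objects:
`exists_isSoftZilberField_not_schanuelProperty`).

BARRIER (D-0021).
- technique_class: categoricity soft-model-theoretic-methods zilber-axioms pseudo-exponentiation quasiminimality abstract-exponential-fields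
- explicit_class: `SoftDerivationOfSchanuel` — arguments that would derive the Schanuel property of `ℂ_exp` from its being an ELA-field of cardinality `𝔠` with standard kernel, exponential-algebraic closedness in the linear-independence form of axiom 4 (`Literature.NumberTheory.Transcendental.IsLinIndepExpAlgClosed`), the countable closure property and quasiminimality / categoricity of Zilber's axioms [cite: BaysKirby2018ANT, §9.1 Theorem 9.1 and §9.2] [cite: Zilber2005PseudoExp, §1].
- blocks: route `Summits/Schanuel/Schanuel/Theses/Zilber.lean` as a PROOF of `Schanuel` (`Literature.Periods.ZilberConjecture → Schanuel` by projection): establishing the remaining Zilber axioms for `ℂ_exp` (EAC/SEAC, CCP, standard kernel, quasiminimality) does not yield `SchanuelProperty ℂ` — `not_softDerivationOfSchanuel`; "Several people have asked us if it might be possible to prove Schanuel's conjecture easily by some method showing that `ℂ_exp` must be isomorphic to `𝔹`, just because `𝔹` is categorical" [cite: BaysKirby2018ANT, §9.2]; consistently, `ℂ_exp ≅ 𝔹` is EQUIVALENT to Schanuel + SEAC [cite: BaysKirby2018ANT, Theorem 1.4] and quasiminimality already follows from EAC alone, "Schanuel's conjecture is not required as a condition for quasiminimality" (tree fact `Literature.NumberTheory.Transcendental.isQuasiminimal_of_isExpAlgClosed`)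 [cite: BaysKirby2018ANT, Theorem 1.5].
- because: for every irreducible `P ∈ ℤ[x, y]` (generic zero with non-zero coordinates) the amalgamation construction over the base `ℚ^{ab}(τ, (ε_m))` with `τ/m ↦ ω_m`, `1/m ↦ ε_m` gives "a canonical model `𝔹_P`, the unique model of cardinality continuum of almost the same list of axioms as those for `𝔹`, except that Schanuel's conjecture has this exception with the formal analogues `ε` and `τ` of `e` and `2πi` being algebraically dependent via the polynomial `P`", quasiminimal, "with counterexamples to the Schanuel property within a finite-dimensional `ℚ`-vector space, but with the Schanuel property holding over that vector space. Each `𝕄(F_base)` is unique up to isomorphism as a model of appropriate axioms, just as `𝔹` is. One could conjecture that `ℂ_exp` is isomorphic to one of these." [cite: BaysKirby2018ANT, §9.2]; the failure of SP in such a field is `not_schanuelProperty_of_kernel_relation`.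
- evasions_known: none published for deriving SP softly; what the axiomatic route does give: `ℂ_exp ≅ 𝔹 ↔ Schanuel ∧ SEAC(ℂ)` [cite: BaysKirby2018ANT, Theorem 1.4], EAC(ℂ) ⟹ quasiminimality without Schanuel [cite: BaysKirby2018ANT, Theorem 1.5], and relative/generic Schanuel statements over a closed base from Ax's theorem ("Ax's versions of Schanuel's conjecture then apply to say that Schanuel's conjecture is true relative to the base") [cite: BaysKirby2018ANT, §1.2] [cite: Ax1971, Thm 3].
- scope_caveats: the printed no-go sentence is informal ("soft methods which ignore transcendental number theory and analytic considerations cannot hope to work") [cite: BaysKirby2018ANT, §9.2]; what is proved in the source is the existence (and categoricity in "appropriate axioms", not formalised here) of the models `𝔹_P`, which in the tree is the NAMED FACT `baysKirby2018_modelsWithoutSchanuel` — not discharged: its proof is the amalgamation-and-excellence construction of §§3–8 [cite: BaysKirby2018ANT, Thm 1.7 and Thm 8.2] (not formalised; the sibling proof file reduces the named fact to that construction over the §9.2 base, `baysKirby2018_modelsWithoutSchanuel_of_softModels`) — so conjunct (ii) of this declaration is the implication from that fact, only conjunct (i) (the mechanism) being unconditional; `baysKirby2018_modelsWithoutSchanuel`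 renders "almost the same list of axioms as those for `𝔹`" as axioms 1, 2, 4 (in the tree's Kirby linear-independence form `Literature.NumberTheory.Transcendental.IsLinIndepExpAlgClosed`, for irreducible `V`), 5 plus quasiminimality and `#F = 𝔠`, and "generic zero with `ε, τ ≠ 0`" as `IsAdmissibleRelation` (irreducible, positive degree in each variable); any property of `ℂ_exp` beyond this list (e.g. analytic or archimedean structure, or `SchanuelProperty` restricted to `ecl ∅`) is outside the technique class and untouched by the barrier; in particular derivations assuming the GENERICITY form of strong exponential-algebraic closedness of `ℂ_exp` (`Literature.IsStronglyExpAlgClosed ℂ`) are not formally refuted here — Theorem 9.1 as printed gives axiom 4 only in the linear-independence form, and Kirby's equivalence of the two forms (`Literature.NumberTheory.Transcendental.kirby2013_isStronglyExpAlgClosed_iff_isLinIndepExpAlgClosed`) uses the Schanuel property, which fails in `𝔹_P` [cite: BaysKirby2018ANT, §9.1 Theorem 9.1 (axiom 4)].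
- status: established [cite: BaysKirby2018ANT, §9.2, Theorem 9.1, Theorems 1.4-1.5]. -/
def AxiomsDoNotForceSchanuel : Prop :=
  (∀ (F : Type) [Field F] [CharZero F] [Literature.ModelTheory.ExponentialFields.ExponentialRing F] (τ : F),
      Transcendental ℚ τ → Literature.ModelTheory.ExponentialFields.ExponentialRing.exp τ = 1 →
      ∀ P : MvPolynomial (Fin 2) ℤ, P ≠ 0 →
        MvPolynomial.aeval ![Literature.ModelTheory.ExponentialFields.ExponentialRing.exp (1 : F), τ] P = 0 →
        ¬ Literature.ModelTheory.ExponentialFields.SchanuelProperty F) ∧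
  (baysKirby2018_modelsWithoutSchanuel → ¬ SoftDerivationOfSchanuel)

/-- **The barrier HOLDS** (PROVED, sorry-free): conjunct (i) is
`not_schanuelProperty_of_kernel_relation`, conjunct (ii) is `not_softDerivationOfSchanuel` (from
the named fact, with the admissible `P = x − y`). [cite: BaysKirby2018ANT, §9.2] -/
theorem axiomsDoNotForceSchanuel_holds : AxiomsDoNotForceSchanuel :=
  ⟨fun _ _ _ _ _ hτ hker _ hP hrel => not_schanuelProperty_of_kernel_relation hτ hker hP hrel,
    not_softDerivationOfSchanuel⟩

/-- Packaged: given Bays–Kirby's counter-models (the named fact), the catalogued barrier refutes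
the soft technique class. [cite: BaysKirby2018ANT, §9.2] -/
theorem AxiomsDoNotForceSchanuel.not_soft (h : AxiomsDoNotForceSchanuel)
    (hmodels : baysKirby2018_modelsWithoutSchanuel) : ¬ SoftDerivationOfSchanuel :=
  h.2 hmodels

/-! ### The technique class as a class of objects (parametrised predicate, D-0021)

`SoftDerivationOfSchanuel` is the CLOSED proposition "every exponential field with the soft
properties has the Schanuel property" — the statement this barrier refutes, not a result of the
source. The class of objects it quantifies over is the parametrised predicate `IsSoftZilberField`
(our name; Bays–Kirby do not name the class): Zilber's axioms 1, 2, 4, 5 of Theorem 9.1 — with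
axiom 4 in the printed "`ℚ`-linearly independent over `ā`" form — together with quasiminimality
and cardinality `𝔠`, i.e. what `ℂ_exp` would share with `𝔹` "just because `𝔹` is categorical",
axiom 3 (the Schanuel property) excepted. Through it the barrier reads
`∃ F, IsSoftZilberField F ∧ ¬ SchanuelProperty F`, equivalently
`¬ ∀ F, IsSoftZilberField F → SchanuelProperty F` (both PROVED from the named fact). -/

/-- **Soft Zilber fields** (the class of objects of the technique class `SoftDerivationOfSchanuel`;
the name is ours): an exponential field `F` of characteristic zero with `#F = 𝔠` which is an
ELA-field ("algebraically closed field of characteristic zero, and `exp` is a surjective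
homomorphism from `𝔾_a(F)` to `𝔾_m(F)`", axiom 1), has standard kernel ("the kernel of `exp` is an
infinite cyclic group generated by a transcendental element `τ`", axiom 2), satisfies strong
exponential-algebraic closedness in the printed form "there is `x̄` in `F` such that
`(x̄, e^x̄) ∈ V` and `x̄` is `ℚ`-linearly independent over `ā`" (axiom 4, tree
`Literature.NumberTheory.Transcendental.IsLinIndepExpAlgClosed`) and the countable closure
property (axiom 5), and is quasiminimal — every axiom of Theorem 9.1 except axiom 3, the Schanuel
property. A parametrised predicate, not a named fact.
[cite: BaysKirby2018ANT, §9.1 Theorem 9.1 (axioms 1, 2, 4, 5) and §9.2] -/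
def IsSoftZilberField (F : Type*) [Field F] [CharZero F]
    [Literature.ModelTheory.ExponentialFields.ExponentialRing F] : Prop :=
  #F = 𝔠 ∧ IsAlgClosed F ∧
    Literature.ModelTheory.ExponentialFields.ExponentialRing.IsSurjectiveOntoUnits F ∧
    Literature.NumberTheory.Transcendental.HasStandardKernel F ∧
    Literature.NumberTheory.Transcendental.IsLinIndepExpAlgClosed F ∧
    Literature.NumberTheory.Transcendental.HasCountableClosureProperty F ∧
    Literature.ModelTheory.ExponentialFields.Language.expRing.IsQuasiminimal F

/-- `SoftDerivationOfSchanuel` says exactly that every soft Zilber field (in `Type`) has the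
Schanuel property (uncurrying the seven hypotheses). [folklore] -/
theorem softDerivationOfSchanuel_iff :
    SoftDerivationOfSchanuel ↔
      ∀ (F : Type) [Field F] [CharZero F]
        [Literature.ModelTheory.ExponentialFields.ExponentialRing F],
        IsSoftZilberField F → Literature.ModelTheory.ExponentialFields.SchanuelProperty F := by
  constructor
  · rintro h F _ _ _ ⟨h1, h2, h3, h4, h5, h6, h7⟩
    exact h F h1 h2 h3 h4 h5 h6 h7
  · intro h F _ _ _ h1 h2 h3 h4 h5 h6 h7
    exact h F ⟨h1, h2, h3, h4, h5, h6, h7⟩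

/-- **Bays–Kirby's `𝔹_P` are soft Zilber fields without the Schanuel property** (PROVED from the
named fact, with the admissible `P = x − y`): "a quasiminimal exponential field … of size
continuum with counterexamples to the Schanuel property", satisfying "almost the same list of
axioms as those for `𝔹`, except that Schanuel's conjecture has this exception".
[cite: BaysKirby2018ANT, §9.2] -/
theorem exists_isSoftZilberField_not_schanuelProperty (h : baysKirby2018_modelsWithoutSchanuel) :
    ∃ (F : Type) (_ : Field F) (_ : CharZero F)
      (_ : Literature.ModelTheory.ExponentialFields.ExponentialRing F),
      IsSoftZilberField F ∧ ¬ Literature.ModelTheory.ExponentialFields.SchanuelProperty F := by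
  obtain ⟨F, _, _, _, hcard, hac, hsurj, ⟨τ, hτ, hker, -, hrel⟩, hlin, hccp, hqm⟩ :=
    h _ isAdmissibleRelation_X_sub_X
  have hτker : Literature.ModelTheory.ExponentialFields.ExponentialRing.exp τ = 1 := by
    rw [← Literature.ModelTheory.ExponentialFields.ExponentialRing.mem_expKernel_iff, hker]
    exact AddSubgroup.mem_zmultiples τ
  exact ⟨F, inferInstance, inferInstance, inferInstance,
    ⟨hcard, hac, hsurj, ⟨τ, hτ, hker⟩, hlin, hccp, hqm⟩,
    not_schanuelProperty_of_kernel_relation hτ hτker isAdmissibleRelation_X_sub_X.1.ne_zero hrel⟩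

/-- **The barrier through the class of objects** (PROVED from the named fact): not every soft
Zilber field has the Schanuel property — "soft methods which ignore transcendental number theory
and analytic considerations cannot hope to work". [cite: BaysKirby2018ANT, §9.2] -/
theorem not_forall_isSoftZilberField_schanuelProperty (h : baysKirby2018_modelsWithoutSchanuel) :
    ¬ ∀ (F : Type) [Field F] [CharZero F]
        [Literature.ModelTheory.ExponentialFields.ExponentialRing F],
        IsSoftZilberField F → Literature.ModelTheory.ExponentialFields.SchanuelProperty F :=
  fun hall => not_softDerivationOfSchanuel h (softDerivationOfSchanuel_iff.mpr hall)

end Literature.Barriers.Schanuel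

end
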